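import Mathlib
import Literature.NumberTheory.ModularSymbols.CuspidalHomologyPrymDefect
import Literature.NumberTheory.EllipticCurves.AlgebraicModularParametrizationWithShift
import Literature.NumberTheory.GaloisRepresentations.IntegralGaloisActionProofs
import HarnessLib

/-!
# ModularJacobianShiftFixedFrobenius

Topic `Literature/NumberTheory/EllipticCurves`. Named literature fact(s) relocated by the gate from `Summits/BirchSwinnertonDyer/BirchSwinnertonDyer/Theorems/TameQuarticManinParityEisensteinSplitOfShiftDatum.lean`
(accept-time relocation of `[cite]`d propositions written inline in a Summits proposal; human ruling 2026-08-15).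
Sources: DarmonDiamondTaylor1995, Harrison2011X0108.

* `Literature.NumberTheory.EllipticCurves.nonempty_shiftDatumEichlerShimuraFixedFrobenius`
-/

namespace Literature.NumberTheory.EllipticCurves

open scoped NumberField
open IsDedekindDomain NumberField Field
open Literature.NumberTheory.EllipticCurves.ModularForms Literature.NumberTheory.ModularSymbols
open Literature.NumberTheory.GaloisRepresentations Rat.HeightOneSpectrum

/-- **The `ℚ`-structure of `J₀(N)` with shift (`9 ∣ N`), together with Eichler–Shimura on `J₀(N)[3]` and the
triviality of Frobenius at `p ≡ 1 (mod N)` on `π₀(J₀(N)^t)`** (named fact, existence form). For every `N` with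
`9 ∣ N` there are an embedding `ι : ℚ̄ → ℂ` and data `A : AlgebraicModularParametrizationWithShift N h9 ι` (Galois action
on `J₀(N)(ℂ)_tors`, `𝕋_ℤ`-linear, with the shift law) such that for every rational prime `p ∤ 3N`, every prime
`𝔓 ∣ p` of `ℤ̄` and every arithmetic Frobenius `φ` at `𝔓`:
(ES₃) `φ(φ x) − T_p (φ x) + p x = 0` for all `x ∈ J₀(N)[3]` — the Eichler–Shimura congruence relation
`T_p = F + ⟨p⟩F'` read on `3`-torsion through an arithmetic Frobenius (Darmon–Diamond–Taylor Thm. 1.29, p. 37, and the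
proof of Thm. 3.1(a), p. 86; Shimura 1971 Thm. 7.9); and
(FIX) if `p ≡ 1 (mod N)`: `φ x − x ∈ Nm J₀(N)` for every torsion point `x` fixed by `t_*` — because
`J₀(N)^t = Nm J₀(N) + ⟨[P − P′] : P, P′ ∈ Fix t⟩` (Hilbert 90 for the cyclic cover
`X₀(N) → X₀(N)/⟨t⟩ ≅ X₀(N/3)`: every `t`-invariant class is the class of a `t`-invariant divisor; Mumford,
Prym varieties I, §3; Accola 1975 Part II §2) and the fixed points of `t` — the cusps `a/c` with `9 ∣ c` and the
points above the order-`3` elliptic points of `X₀(N/3)` (CM by `ℤ[ζ₃]`) — are rational over `ℚ(ζ_N)` (Ogg 1973 §2;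
Shimura 1971 §6 / Silverman ATAEC II.2.2), where `Frob_p = id` for `p ≡ 1 (mod N)`.
[cite: DarmonDiamondTaylor1995, Thm. 1.29 (p. 37), §1.5 (pp. 34–38), proof of Thm. 3.1(a) (p. 86)]
[cite: Harrison2011X0108, §2] [file NumberTheory/EllipticCurves/ModularJacobianShiftFixedFrobenius] -/
def nonempty_shiftDatumEichlerShimuraFixedFrobenius : Prop :=
  ∀ (N : ℕ) [NeZero N] (h9 : 3 ^ 2 ∣ N),
    ∃ (ι : AlgebraicClosure ℚ →+* ℂ) (A : AlgebraicModularParametrizationWithShift N h9 ι),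
      ∀ (v : HeightOneSpectrum (𝓞 ℚ)), ¬ ((primesEquiv v : Nat.Primes) : ℕ) ∣ 3 * N →
        ∀ 𝔓 ∈ v.primesAbove, ∀ φ : Field.absoluteGaloisGroup ℚ, IsArithFrobAt (𝓞 ℚ) φ 𝔓 →
          (∀ x : J0.tors N, (3 : HeckeRing0 N 2) • x = 0 →
            A.galAct φ (A.galAct φ x)
              - HeckeRing0.T N 2 ((primesEquiv v : Nat.Primes) : ℕ) (primesEquiv v : Nat.Primes).2 • A.galAct φ x
              + (((primesEquiv v : Nat.Primes) : ℕ) : HeckeRing0 N 2) • x = 0) ∧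
          (((primesEquiv v : Nat.Primes) : ℕ) ≡ 1 [MOD N] →
            ∀ x : J0.tors N, x ∈ J0.torsFixedByShift N h9 →
              ((A.galAct φ x : J0.tors N) : J0 N) - (x : J0 N) ∈ normRange N h9)

end Literature.NumberTheory.EllipticCurves
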